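import Summits.QuantumFields.YangMills.Theorems.BalabanUVNodesN19JointLawBernstein
import Summits.QuantumFields.YangMills.Theorems.BalabanUVNodesN19ContinuumStringFieldStructure

/-!
# YM-DAG node N19 (= NE7 proper) — A RATE FOR THE CONTINUUM JOINT LAWS (tensor Bernstein + the string-independent expectation rate)

Cell `pub-ymgap`, HUMAN RULING D-0062 (Track A), R141 (C) wider-strategy seat `pub-ymgap-dag-n19-e` (strategy s3 = ALTERNATIVE CURRENCY), generation
g19, module 4 (lineage module 56).  Route `Summits/QuantumFields/YangMills/Theses/BalabanUVNodes.lean` rev 25, cluster item K3⁷ «SpineGivenEndpointR13SepCoPH»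
(stmt-QuantumFields-20544, dag-lead WORDS-143); filed `--supports` that item `--as helper` (it proves no registered stub).  COUNT-NEUTRAL: bookkeeping over
the sibling p568465 `…N19JointLawBernstein` (tensor Bernstein approximation `abs_tensorBernstein_sub_le_card`, pricing `abs_integral_tensorBernstein_sub_le`,
`eval_bernAff`), the seat's p558060 `…N19ContinuumJointLaws` (`prodObs_mixedString`, `exists_jointContinuumLaw_of_hasContinuumLimit`) and p482030
`…N19ExpectationCurrencyTwoConstantsRate` (`abs_expectAt_sub_lim_le_linlog_tail_of_target`) and p566839 `…N19ContinuumStringFieldStructure`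
(`hasContinuumLimit_of_uniformTarget`) BY NAME; `Spine.NE7.Target` (N19's DECL-target shape, NOT PRINTED, NOT proved) is a HYPOTHESIS; no Theses import;
NOT a discharge claim.

THE RESULT.  §1 generic [folklore]: two probability laws `P`, `Q` on `ℝ^ι` (`ι` finite) carried by `[−1,1]^ι` whose mixed moments of coordinate degrees
`≤ n` differ by at most `r` are `2K|ι|∕√n + G·2^{n|ι|}·r`-close on every continuous `f` with `|f u − f v| ≤ K Σ_i|u_i − v_i|` and `|f| ≤ G` on the cube
(★ `abs_integral_sub_integral_le_of_mixedMoments`: approximate by the tensor Bernstein polynomial of degree `n`, price it at the moments).  §2 at the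
scheme: under N19's DECL-target shape for EVERY string with COMMON data (`∀ os, Spine.NE7.Target vol l₀ δ (schemeZ S os)`, `0 < l₀`), every mixed moment
`E_K[∏_i (∏os_i)^{j_i}]` of a finite family of strings is within `R_K = (4e^{1+l₀}∕l₀)·τ_K·(1 + log⁺ τ_K⁻¹)`, `τ_K = Σ_m 2·vol·δ_{K+m}`, of its continuum value
(it is the expectation of ONE concatenated string — p558060 `prodObs_mixedString` — and p482030's rate does not see the string: ★ `abs_mixedMoment_sub_integral_le_of_uniformTarget`),
hence ★★ `abs_integral_sub_jointLaw_le_of_uniformTarget`: for the continuum joint law `ν` of `(∏os_i)_{i∈ι}` (p558060) and every such `f`, every `n ≥ 1`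
and every `K`,
  `|∫ f((∏os_i)_i) dgibbs_K − ∫ f dν| ≤ 2K|ι|∕√n + G·2^{n|ι|}·R_K`
— THE FIRST RATE FOR THE CONTINUUM JOINT LAWS (p558060 had none: «a multivariate Jackson theorem is not in the tree»; the tensor Bernstein operator is the
cheap substitute, at the cost of `n^{−1∕2}` instead of Jackson's `n^{−1}`).  Choosing `n ≍ log R_K⁻¹ ∕ |ι|` gives a bounded-Lipschitz rate of order
`K|ι|^{3∕2}∕√(log R_K⁻¹) + G√R_K`; ★ `jointLaw_boundedLipschitz_of_uniformTarget` records the uniform form (∀ η ∃ K₀ ∀ K ≥ K₀ ∀ f with K, G ≤ 1: `≤ η`).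
For ONE string the sharp rate is p556871's `log(e+L_K)∕(1+L_K)`; the joint rate here is NOT claimed sharp.

HONEST FRAMING (binding).  [folklore] ∕ bookkeeping; NO consumer in the DAG today; `Target` ∕ the law hypotheses are HYPOTHESES; nothing of Bałaban's
instantiated; NE7 NOT PRINTED, NOT proved; N19 NOT discharged; count-neutral.  One finite `T⁴` programme at fixed `ε` → 0 at FIXED volume; NOT a continuum ∕
`ℝ⁴` ∕ infinite-volume ∕ OS ∕ mass-gap ∕ Clay statement.  0 `def` ∕ 0 `sorry`.
-/

noncomputable section

open Real Finset Filter Topology MeasureTheory ProbabilityTheory Polynomial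
open scoped unitInterval

namespace Summit.QuantumFields.YangMills.Theorems.BalabanUVNodesN19JointLawRate

open Literature.MathematicalPhysics.QuantumFieldTheory.Balaban1983to89
open T4GenFunBounds (prodObs gibbsMeasure schemeZ expectAt_eq_integral_gibbs)
open Missing (TorusScheme HasContinuumLimit)
open Summit.QuantumFields.BalabanUV.T4Continuum.Spine
open Summit.QuantumFields.YangMills.Theorems.BalabanUVNodesN19JointLawBernstein
  (abs_tensorBernstein_sub_le_card abs_integral_tensorBernstein_sub_le eval_bernAff integrable_of_continuous_of_cube)
open Summit.QuantumFields.YangMills.Theorems.BalabanUVNodesN19ContinuumJointLaws (prodObs_mixedString exists_jointContinuumLaw_of_hasContinuumLimit)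
open Summit.QuantumFields.YangMills.BalabanUVNodes.N19ExpectationCurrencyAtScheme (mul_nonneg_of_matchingModConstants)
open Summit.QuantumFields.YangMills.Theorems.BalabanUVNodesN19ContinuumStringFieldStructure (hasContinuumLimit_of_uniformTarget)
open Summit.QuantumFields.YangMills.BalabanUVNodes.N19ExpectationCurrencyTwoConstantsRate
  (abs_expectAt_sub_lim_le_linlog_tail_of_target tendsto_linlog_of_tendsto_zero)

/-! ## §1 Generic: mixed moments `r`-close up to degree `n` ⇒ `2K|ι|∕√n + G·2^{n|ι|}·r`-close on Lipschitz functions [folklore] -/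

section Generic

variable {ι : Type*} [Fintype ι] [DecidableEq ι]

/-- ★ **FROM MIXED MOMENTS TO LIPSCHITZ OBSERVABLES ON THE CUBE** [folklore]: probability laws `P`, `Q` on `ℝ^ι` carried by `[−1,1]^ι` with
`|∫ ∏_i x_i^{j_i} dP − ∫ ∏_i x_i^{j_i} dQ| ≤ r` for all `j : ι → {0..n}` (`n ≥ 1`, `0 ≤ r`); `f` continuous with `|f u − f v| ≤ K Σ_i |u_i − v_i|` and `|f| ≤ G` on the
cube.  Then `|∫ f dP − ∫ f dQ| ≤ 2K|ι|∕√n + G·2^{n|ι|}·r` (tensor Bernstein polynomial of `f ∘ (2·−1)` evaluated at `(1+x)∕2`: `K|ι|∕√n`-close to `f` on the cube under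
both laws; priced at the moments by the sibling's `abs_integral_tensorBernstein_sub_le`). -/
theorem abs_integral_sub_integral_le_of_mixedMoments {P Q : Measure (ι → ℝ)} [IsProbabilityMeasure P] [IsProbabilityMeasure Q]
    (hP : P (Set.pi Set.univ (fun _ : ι => Set.Icc (-1 : ℝ) 1))ᶜ = 0) (hQ : Q (Set.pi Set.univ (fun _ : ι => Set.Icc (-1 : ℝ) 1))ᶜ = 0)
    {n : ℕ} (hn : n ≠ 0) {r : ℝ} (hr : 0 ≤ r)
    (hmom : ∀ j : ι → Fin (n + 1), |∫ x, ∏ i, x i ^ (j i : ℕ) ∂P - ∫ x, ∏ i, x i ^ (j i : ℕ) ∂Q| ≤ r)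
    {f : (ι → ℝ) → ℝ} (hf : Continuous f) {K G : ℝ} (hK0 : 0 ≤ K)
    (hK : ∀ u v : ι → ℝ, (∀ i, u i ∈ Set.Icc (-1 : ℝ) 1) → (∀ i, v i ∈ Set.Icc (-1 : ℝ) 1) → |f u - f v| ≤ K * ∑ i, |u i - v i|)
    (hG : ∀ u : ι → ℝ, (∀ i, u i ∈ Set.Icc (-1 : ℝ) 1) → |f u| ≤ G) :
    |∫ x, f x ∂P - ∫ x, f x ∂Q| ≤ 2 * K * (Fintype.card ι / Real.sqrt n) + G * 2 ^ (n * Fintype.card ι) * r := by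
  classical
  -- the tensor Bernstein polynomial of `f` transported to `[−1,1]^ι`
  set T : (ι → ℝ) → ℝ := fun x => ∑ k : ι → Fin (n + 1), f (fun i => 2 * (((k i : ℕ) : ℝ) / n) - 1) * ∏ i,
      (C (n.choose (k i) : ℝ) * (C (1 / 2 : ℝ) * (X + 1)) ^ (k i : ℕ) * (C (1 / 2 : ℝ) * (1 - X)) ^ (n - k i)).eval (x i) with hTdef
  have hTc : Continuous T := continuous_finsetSum _ fun k _ => continuous_const.mul
    (continuous_finsetProd _ fun i _ => (Polynomial.continuous _).comp (continuous_apply i))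
  have hnr : (0 : ℝ) < n := by exact_mod_cast Nat.pos_of_ne_zero hn
  -- node values lie in the cube
  have hnode : ∀ k : ι → Fin (n + 1), ∀ i, 2 * (((k i : ℕ) : ℝ) / n) - 1 ∈ Set.Icc (-1 : ℝ) 1 := fun k i => by
    have h0 : (0 : ℝ) ≤ ((k i : ℕ) : ℝ) / n := div_nonneg (Nat.cast_nonneg _) hnr.le
    have h1 : ((k i : ℕ) : ℝ) / n ≤ 1 := (div_le_one hnr).2 (by exact_mod_cast Nat.lt_succ_iff.1 (k i).2)
    constructor <;> linarith
  -- approximation on the cube: `|T x − f x| ≤ K|ι|∕√n`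
  have happrox : ∀ x : ι → ℝ, (∀ i, x i ∈ Set.Icc (-1 : ℝ) 1) → |T x - f x| ≤ K * (Fintype.card ι / Real.sqrt n) := by
    intro x hx
    have hy : ∀ i, (1 + x i) / 2 ∈ Set.Icc (0 : ℝ) 1 := fun i => by constructor <;> linarith [(hx i).1, (hx i).2]
    let y : ι → I := fun i => ⟨(1 + x i) / 2, hy i⟩
    have hg : ∀ u v : ι → ℝ, (∀ i, u i ∈ Set.Icc (0 : ℝ) 1) → (∀ i, v i ∈ Set.Icc (0 : ℝ) 1) →
        |f (fun i => 2 * u i - 1) - f (fun i => 2 * v i - 1)| ≤ 2 * K * ∑ i, |u i - v i| := by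
      intro u v hu hv
      refine (hK _ _ (fun i => ⟨by linarith [(hu i).1], by linarith [(hu i).2]⟩)
        (fun i => ⟨by linarith [(hv i).1], by linarith [(hv i).2]⟩)).trans (le_of_eq ?_)
      have h2 : ∀ i, |2 * u i - 1 - (2 * v i - 1)| = 2 * |u i - v i| := fun i => by
        rw [show (2 : ℝ) * u i - 1 - (2 * v i - 1) = 2 * (u i - v i) by ring, abs_mul, abs_two]
      simp only [h2, ← Finset.mul_sum]
      ring
    have h := abs_tensorBernstein_sub_le_card (g := fun u => f (fun i => 2 * u i - 1)) (by positivity) hg hn y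
    have hT : T x = ∑ k : ι → Fin (n + 1), f (fun i => 2 * (((k i : ℕ) : ℝ) / n) - 1) * ∏ i, bernstein n (k i) (y i) := by
      simp only [hTdef]
      refine Finset.sum_congr rfl fun k _ => ?_
      rw [Finset.prod_congr rfl fun i _ => eval_bernAff n (k i) (x i) (hx i)]
    have hfx : f x = f (fun i => 2 * ((y i : ℝ)) - 1) := by
      congr 1; funext i; simp only [y]; ring
    rw [hT, hfx]
    exact h.trans (le_of_eq (by ring))
  -- the two approximation errors under `P` and `Q`
  have herr : ∀ (μ₀ : Measure (ι → ℝ)) [IsProbabilityMeasure μ₀], μ₀ (Set.pi Set.univ (fun _ : ι => Set.Icc (-1 : ℝ) 1))ᶜ = 0 →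
      |∫ x, f x ∂μ₀ - ∫ x, T x ∂μ₀| ≤ K * (Fintype.card ι / Real.sqrt n) := by
    intro μ₀ _ hR
    have hsub : ∫ x, f x ∂μ₀ - ∫ x, T x ∂μ₀ = ∫ x, (f x - T x) ∂μ₀ :=
      (integral_sub (integrable_of_continuous_of_cube hR hf) (integrable_of_continuous_of_cube hR hTc)).symm
    have hae : ∀ᵐ x ∂μ₀, x ∈ Set.pi Set.univ (fun _ : ι => Set.Icc (-1 : ℝ) 1) := mem_ae_iff.2 hR
    rw [hsub, ← Real.norm_eq_abs]
    refine (norm_integral_le_of_norm_le_const (hae.mono fun x hx => ?_)).trans (by rw [probReal_univ, mul_one])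
    rw [Real.norm_eq_abs, abs_sub_comm]
    exact happrox x fun i => Set.mem_univ_pi.1 hx i
  -- pricing the polynomial at the moments
  have hprice : |∫ x, T x ∂P - ∫ x, T x ∂Q| ≤ G * 2 ^ (n * Fintype.card ι) * r :=
    abs_integral_tensorBernstein_sub_le hP hQ hr hmom (c := fun k : ι → Fin (n + 1) => f (fun i => 2 * (((k i : ℕ) : ℝ) / n) - 1))
      fun k => hG _ (hnode k)
  have hPe := herr P hP
  have hQe := herr Q hQ
  rw [abs_sub_comm] at hQe
  calc |∫ x, f x ∂P - ∫ x, f x ∂Q|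
      = |(∫ x, f x ∂P - ∫ x, T x ∂P) + (∫ x, T x ∂P - ∫ x, T x ∂Q) + (∫ x, T x ∂Q - ∫ x, f x ∂Q)| := by ring_nf
    _ ≤ |∫ x, f x ∂P - ∫ x, T x ∂P| + |∫ x, T x ∂P - ∫ x, T x ∂Q| + |∫ x, T x ∂Q - ∫ x, f x ∂Q| := abs_add_three _ _ _
    _ ≤ K * (Fintype.card ι / Real.sqrt n) + G * 2 ^ (n * Fintype.card ι) * r + K * (Fintype.card ι / Real.sqrt n) := by
        linarith
    _ = 2 * K * (Fintype.card ι / Real.sqrt n) + G * 2 ^ (n * Fintype.card ι) * r := by ring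

end Generic

/-! ## §2 At the scheme under uniform `Target`: one rate for all mixed moments, hence a rate for the continuum joint laws -/

section Scheme

variable {G : Type*} [GaugeGroup G] [MeasurableSpace G] [RegularGaugeGroup G] [HaarData G] {O : Type*}
  (S : TorusScheme G O) (hβ : ∀ K, 0 ≤ S.β K) (hm : ∀ K o, Measurable (S.obs K o))
  (h1 : ∀ K o U, |S.obs K o U| ≤ 1)

include hβ hm h1

/-- ★ **ONE RATE FOR EVERY MIXED MOMENT OF A FINITE FAMILY OF STRINGS** [bookkeeping]: under uniform `Target` (`0 < l₀`), if `ν` receives the limits of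
all continuous functionals of `(∏os_i)_{i∈ι}`, then for every `j : ι → ℕ` and every `K`,
`|∫ ∏_i (∏os_i)^{j_i} dgibbs_K − ∫ ∏_i x_i^{j_i} dν| ≤ (4e^{1+l₀}∕l₀)·τ_K·(1 + log⁺ τ_K⁻¹)` — the mixed moment is the expectation of one concatenated string
(p558060 `prodObs_mixedString`), p482030's rate under `Target` is string-independent, and its limit is `ν`'s mixed moment by uniqueness of limits. -/
theorem abs_mixedMoment_sub_integral_le_of_uniformTarget {ι : Type*} [Fintype ι] {vol l₀ : ℝ} {δ : ℕ → ℝ} (hl₀ : 0 < l₀)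
    (hT : ∀ os : List O, NE7.Target vol l₀ δ (schemeZ S os)) (os : ι → List O) (ν : Measure (ι → ℝ))
    (hν : ∀ f : (ι → ℝ) → ℝ, Continuous f →
      Tendsto (fun K => ∫ U, f (fun i => prodObs S K (os i) U) ∂gibbsMeasure (S.P K) (S.β K)) atTop (𝓝 (∫ x, f x ∂ν)))
    (j : ι → ℕ) (K : ℕ) :
    |∫ U, ∏ i, prodObs S K (os i) U ^ j i ∂gibbsMeasure (S.P K) (S.β K) - ∫ x, ∏ i, x i ^ j i ∂ν| ≤
      4 * Real.exp (1 + l₀) / l₀ * (∑' m, 2 * (vol * δ (K + m))) * (1 + Real.posLog (∑' m, 2 * (vol * δ (K + m)))⁻¹) := by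
  set osj : List O := (Finset.univ.toList.map fun i => (List.replicate (j i) (os i)).flatten).flatten with hosj
  have hE : ∀ K, ∫ U, ∏ i, prodObs S K (os i) U ^ j i ∂gibbsMeasure (S.P K) (S.β K) = S.expectAt K osj := fun K => by
    rw [expectAt_eq_integral_gibbs S hβ K]
    exact (integral_congr_ae (ae_of_all _ fun U => prodObs_mixedString S K os j U)).symm
  obtain ⟨E, hEt, hrate⟩ := abs_expectAt_sub_lim_le_linlog_tail_of_target S hβ hm h1 hl₀ osj (hT osj)
  have hlim : Tendsto (fun K => S.expectAt K osj) atTop (𝓝 (∫ x, ∏ i, x i ^ j i ∂ν)) :=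
    (hν _ (continuous_finsetProd _ fun i _ => (continuous_apply i).pow _)).congr fun K => hE K
  rw [hE, ← tendsto_nhds_unique hEt hlim]
  exact hrate K

/-- **★★ A RATE FOR THE CONTINUUM JOINT LAWS** [folklore + bookkeeping].  For a torus scheme with `β_K ≥ 0` and measurable observables bounded by `1`, under
N19's DECL-target shape for EVERY string with common data (`∀ os, Spine.NE7.Target vol l₀ δ (schemeZ S os)`, `0 < l₀` — HYPOTHESIS): if `ν` is a probability
law on `ℝ^ι` carried by `[−1,1]^ι` receiving the limits of all continuous functionals of the finite family `(∏os_i)_{i∈ι}` (p558060's continuum joint law), then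
for every continuous `f` with `|f u − f v| ≤ K_f Σ_i|u_i − v_i|` and `|f| ≤ G_f` on the cube, every `n ≥ 1` and every step `K`:
`|∫ f((∏os_i)_i) dgibbs_K − ∫ f dν| ≤ 2K_f|ι|∕√n + G_f·2^{n|ι|}·(4e^{1+l₀}∕l₀)·τ_K·(1 + log⁺ τ_K⁻¹)`, `τ_K = Σ_m 2·vol·δ_{K+m}`.  NOT claimed sharp. -/
theorem abs_integral_sub_jointLaw_le_of_uniformTarget {ι : Type*} [Fintype ι] [DecidableEq ι] {vol l₀ : ℝ} {δ : ℕ → ℝ} (hl₀ : 0 < l₀)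
    (hT : ∀ os : List O, NE7.Target vol l₀ δ (schemeZ S os)) (os : ι → List O) (ν : Measure (ι → ℝ)) [IsProbabilityMeasure ν]
    (hν1 : ν (Set.pi Set.univ (fun _ : ι => Set.Icc (-1 : ℝ) 1))ᶜ = 0)
    (hν : ∀ f : (ι → ℝ) → ℝ, Continuous f →
      Tendsto (fun K => ∫ U, f (fun i => prodObs S K (os i) U) ∂gibbsMeasure (S.P K) (S.β K)) atTop (𝓝 (∫ x, f x ∂ν)))
    {f : (ι → ℝ) → ℝ} (hf : Continuous f) {Kf Gf : ℝ} (hK0 : 0 ≤ Kf)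
    (hK : ∀ u v : ι → ℝ, (∀ i, u i ∈ Set.Icc (-1 : ℝ) 1) → (∀ i, v i ∈ Set.Icc (-1 : ℝ) 1) → |f u - f v| ≤ Kf * ∑ i, |u i - v i|)
    (hG : ∀ u : ι → ℝ, (∀ i, u i ∈ Set.Icc (-1 : ℝ) 1) → |f u| ≤ Gf) {n : ℕ} (hn : n ≠ 0) (K : ℕ) :
    |∫ U, f (fun i => prodObs S K (os i) U) ∂gibbsMeasure (S.P K) (S.β K) - ∫ x, f x ∂ν| ≤
      2 * Kf * (Fintype.card ι / Real.sqrt n) + Gf * 2 ^ (n * Fintype.card ι) *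
        (4 * Real.exp (1 + l₀) / l₀ * (∑' m, 2 * (vol * δ (K + m))) * (1 + Real.posLog (∑' m, 2 * (vol * δ (K + m)))⁻¹)) := by
  haveI hP : IsProbabilityMeasure (gibbsMeasure (G := G) (S.P K) (S.β K)) := T4GenFunBounds.isProbabilityMeasure_gibbsMeasure (G := G) (S.P K) (hβ K)
  -- the step-`K` joint law as a law on `ℝ^ι`
  have hvec : Measurable fun U : GaugeField (S.P K) 0 G => fun i => prodObs S K (os i) U :=
    measurable_pi_lambda _ fun i => T4GenFunBounds.measurable_prodObs S hm K (os i)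
  set P : Measure (ι → ℝ) := (gibbsMeasure (S.P K) (S.β K)).map fun U => fun i => prodObs S K (os i) U with hPdef
  haveI : IsProbabilityMeasure P := Measure.isProbabilityMeasure_map hvec.aemeasurable
  have hPc : P (Set.pi Set.univ (fun _ : ι => Set.Icc (-1 : ℝ) 1))ᶜ = 0 := by
    rw [hPdef, Measure.map_apply hvec (MeasurableSet.univ_pi fun _ => measurableSet_Icc).compl]
    have he : (fun U : GaugeField (S.P K) 0 G => fun i => prodObs S K (os i) U) ⁻¹' (Set.pi Set.univ (fun _ : ι => Set.Icc (-1 : ℝ) 1))ᶜ = ∅ := by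
      ext U
      simp only [Set.mem_preimage, Set.mem_compl_iff, Set.mem_empty_iff_false, iff_false, not_not, Set.mem_univ_pi]
      exact fun i => abs_le.1 (T4GenFunBounds.abs_prodObs_le_one S h1 K (os i) _)
    rw [he, measure_empty]
  have hint : ∀ {h : (ι → ℝ) → ℝ}, Continuous h → ∫ x, h x ∂P = ∫ U, h (fun i => prodObs S K (os i) U) ∂gibbsMeasure (S.P K) (S.β K) :=
    fun hh => integral_map hvec.aemeasurable hh.aestronglyMeasurable
  -- nonnegativity of the rate
  have hτ0 : 0 ≤ ∑' m, 2 * (vol * δ (K + m)) := tsum_nonneg fun m => mul_nonneg two_pos.le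
    (mul_nonneg_of_matchingModConstants hl₀.le (hT []).1 (K + m))
  have hR0 : 0 ≤ 4 * Real.exp (1 + l₀) / l₀ * (∑' m, 2 * (vol * δ (K + m))) * (1 + Real.posLog (∑' m, 2 * (vol * δ (K + m)))⁻¹) :=
    mul_nonneg (mul_nonneg (div_nonneg (mul_nonneg (by norm_num) (Real.exp_pos _).le) hl₀.le) hτ0)
      (add_nonneg zero_le_one Real.posLog_nonneg)
  -- mixed moments up to degree `n` (indeed all) are `R_K`-close
  have hmom : ∀ jj : ι → Fin (n + 1), |∫ x, ∏ i, x i ^ (jj i : ℕ) ∂P - ∫ x, ∏ i, x i ^ (jj i : ℕ) ∂ν| ≤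
      4 * Real.exp (1 + l₀) / l₀ * (∑' m, 2 * (vol * δ (K + m))) * (1 + Real.posLog (∑' m, 2 * (vol * δ (K + m)))⁻¹) := fun jj => by
    rw [hint (h := fun x : ι → ℝ => ∏ i, x i ^ (jj i : ℕ)) (continuous_finsetProd _ fun i _ => (continuous_apply i).pow _)]
    exact abs_mixedMoment_sub_integral_le_of_uniformTarget S hβ hm h1 hl₀ hT os ν hν (fun i => (jj i : ℕ)) K
  rw [← hint hf]
  exact abs_integral_sub_integral_le_of_mixedMoments hPc hν1 hn hR0 hmom hf hK0 hK hG

/-- **★ UNIFORM BOUNDED-LIPSCHITZ CONVERGENCE OF THE CONTINUUM JOINT LAW** [bookkeeping]: under uniform `Target` (`0 < l₀`), with `ν` as above, for every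
`η > 0` there is `K₀` such that for all `K ≥ K₀` and ALL continuous `f` with `|f u − f v| ≤ Σ_i|u_i − v_i|` and `|f| ≤ 1` on the cube:
`|∫ f((∏os_i)_i) dgibbs_K − ∫ f dν| ≤ η` — ONE `K₀` for the whole bounded-Lipschitz unit ball (first fix the Bernstein degree `n` with `2|ι|∕√n ≤ η∕2`, then
`K₀` with `2^{n|ι|}·R_K ≤ η∕2`, `R_K → 0` by p482030 `tendsto_linlog_of_tendsto_zero`). -/
theorem jointLaw_boundedLipschitz_of_uniformTarget {ι : Type*} [Fintype ι] [DecidableEq ι] {vol l₀ : ℝ} {δ : ℕ → ℝ} (hl₀ : 0 < l₀)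
    (hT : ∀ os : List O, NE7.Target vol l₀ δ (schemeZ S os)) (os : ι → List O) (ν : Measure (ι → ℝ)) [IsProbabilityMeasure ν]
    (hν1 : ν (Set.pi Set.univ (fun _ : ι => Set.Icc (-1 : ℝ) 1))ᶜ = 0)
    (hν : ∀ f : (ι → ℝ) → ℝ, Continuous f →
      Tendsto (fun K => ∫ U, f (fun i => prodObs S K (os i) U) ∂gibbsMeasure (S.P K) (S.β K)) atTop (𝓝 (∫ x, f x ∂ν)))
    {η : ℝ} (hη : 0 < η) :
    ∃ K₀ : ℕ, ∀ K, K₀ ≤ K → ∀ f : (ι → ℝ) → ℝ, Continuous f →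
      (∀ u v : ι → ℝ, (∀ i, u i ∈ Set.Icc (-1 : ℝ) 1) → (∀ i, v i ∈ Set.Icc (-1 : ℝ) 1) → |f u - f v| ≤ ∑ i, |u i - v i|) →
      (∀ u : ι → ℝ, (∀ i, u i ∈ Set.Icc (-1 : ℝ) 1) → |f u| ≤ 1) →
        |∫ U, f (fun i => prodObs S K (os i) U) ∂gibbsMeasure (S.P K) (S.β K) - ∫ x, f x ∂ν| ≤ η := by
  -- the rate `R_K → 0`
  set τ : ℕ → ℝ := fun K => ∑' m, 2 * (vol * δ (K + m)) with hτ
  have hτ0 : ∀ K, 0 ≤ τ K := fun K =>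
    tsum_nonneg fun m => mul_nonneg two_pos.le (mul_nonneg_of_matchingModConstants hl₀.le (hT []).1 (K + m))
  have hτlim : Tendsto τ atTop (𝓝 0) := by
    have h := tendsto_sum_nat_add fun j => 2 * (vol * δ j)
    have e : (fun i : ℕ => ∑' k : ℕ, 2 * (vol * δ (k + i))) = τ := by
      funext i
      show (∑' k : ℕ, 2 * (vol * δ (k + i))) = ∑' m, 2 * (vol * δ (i + m))
      exact tsum_congr fun k => by rw [add_comm]
    rwa [e] at h
  -- the Bernstein degree: `2|ι|∕√n ≤ η∕2`
  set d : ℝ := (Fintype.card ι : ℝ) with hd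
  have hd0 : 0 ≤ d := Nat.cast_nonneg _
  obtain ⟨n, hn0, hn⟩ : ∃ n : ℕ, n ≠ 0 ∧ 2 * (d / Real.sqrt n) ≤ η / 2 := by
    refine ⟨⌈(4 * d / η) ^ 2⌉₊ + 1, Nat.succ_ne_zero _, ?_⟩
    have hs : 4 * d / η ≤ Real.sqrt ((⌈(4 * d / η) ^ 2⌉₊ + 1 : ℕ) : ℝ) := by
      refine Real.le_sqrt_of_sq_le ?_
      push_cast
      linarith [Nat.le_ceil ((4 * d / η) ^ 2)]
    have hspos : 0 < Real.sqrt ((⌈(4 * d / η) ^ 2⌉₊ + 1 : ℕ) : ℝ) := Real.sqrt_pos.2 (by positivity)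
    rw [mul_div_assoc', div_le_iff₀ hspos]
    calc 2 * d = η / 2 * (4 * d / η) := by field_simp; ring
      _ ≤ η / 2 * Real.sqrt ((⌈(4 * d / η) ^ 2⌉₊ + 1 : ℕ) : ℝ) := mul_le_mul_of_nonneg_left hs (by positivity)
  -- the step `K₀`: `2^{n|ι|}·R_K ≤ η∕2` eventually
  have hRlim : Tendsto (fun K => (2 : ℝ) ^ (n * Fintype.card ι) * (4 * Real.exp (1 + l₀) / l₀ * τ K * (1 + Real.posLog (τ K)⁻¹)))
      atTop (𝓝 0) := by
    simpa using (tendsto_linlog_of_tendsto_zero hτ0 hτlim (4 * Real.exp (1 + l₀) / l₀)).const_mul ((2 : ℝ) ^ (n * Fintype.card ι))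
  obtain ⟨K₀, hK₀⟩ := Filter.eventually_atTop.1 (hRlim.eventually (ge_mem_nhds (half_pos hη)))
  refine ⟨K₀, fun K hK f hf hLip hbd => ?_⟩
  have h := abs_integral_sub_jointLaw_le_of_uniformTarget S hβ hm h1 hl₀ hT os ν hν1 hν hf zero_le_one (Kf := 1) (Gf := 1)
    (fun u v hu hv => by rw [one_mul]; exact hLip u v hu hv) hbd hn0 K
  have h2 := hK₀ K hK
  rw [one_mul] at h
  linarith

/-- **★ … AND FOR THE CYLINDER FUNCTIONALS OF THE WHOLE STRING-FIELD LAW** [bookkeeping]: under uniform `Target` (`0 < l₀`), if a probability law `Λ` on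
`ℝ^{List O}` carried by the cube receives the limits of all continuous functionals of the string field `(∏os)_{os}` (the seat's `…N19ContinuumStringFieldLaw`,
`[Countable O]`), then for every finite family `os : ι → List O` and every admissible `f`, `n ≥ 1`, `K`:
`|∫ f((∏os_i)_i) dgibbs_K − ∫ f(x ∘ os) dΛ(x)| ≤ 2K_f|ι|∕√n + G_f·2^{n|ι|}·R_K` (the marginal `Λ.map (· ∘ os)` is the joint law of the family). -/
theorem abs_integral_cylinder_sub_le_of_uniformTarget [Countable O] {ι : Type*} [Fintype ι] [DecidableEq ι] {vol l₀ : ℝ} {δ : ℕ → ℝ}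
    (hl₀ : 0 < l₀) (hT : ∀ os : List O, NE7.Target vol l₀ δ (schemeZ S os)) (os : ι → List O) (Λ : Measure (List O → ℝ)) [IsProbabilityMeasure Λ]
    (hΛ1 : Λ (Set.pi Set.univ (fun _ : List O => Set.Icc (-1 : ℝ) 1))ᶜ = 0)
    (hΛ : ∀ F : (List O → ℝ) → ℝ, Continuous F →
      Tendsto (fun K => ∫ U, F (fun os' => prodObs S K os' U) ∂gibbsMeasure (S.P K) (S.β K)) atTop (𝓝 (∫ x, F x ∂Λ)))
    {f : (ι → ℝ) → ℝ} (hf : Continuous f) {Kf Gf : ℝ} (hK0 : 0 ≤ Kf)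
    (hK : ∀ u v : ι → ℝ, (∀ i, u i ∈ Set.Icc (-1 : ℝ) 1) → (∀ i, v i ∈ Set.Icc (-1 : ℝ) 1) → |f u - f v| ≤ Kf * ∑ i, |u i - v i|)
    (hG : ∀ u : ι → ℝ, (∀ i, u i ∈ Set.Icc (-1 : ℝ) 1) → |f u| ≤ Gf) {n : ℕ} (hn : n ≠ 0) (K : ℕ) :
    |∫ U, f (fun i => prodObs S K (os i) U) ∂gibbsMeasure (S.P K) (S.β K) - ∫ x, f (fun i => x (os i)) ∂Λ| ≤
      2 * Kf * (Fintype.card ι / Real.sqrt n) + Gf * 2 ^ (n * Fintype.card ι) *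
        (4 * Real.exp (1 + l₀) / l₀ * (∑' m, 2 * (vol * δ (K + m))) * (1 + Real.posLog (∑' m, 2 * (vol * δ (K + m)))⁻¹)) := by
  have hr : Continuous fun x : List O → ℝ => fun i => x (os i) := continuous_pi fun i => continuous_apply (os i)
  haveI : IsProbabilityMeasure (Λ.map fun x : List O → ℝ => fun i => x (os i)) := Measure.isProbabilityMeasure_map hr.measurable.aemeasurable
  have hc : (Λ.map fun x : List O → ℝ => fun i => x (os i)) (Set.pi Set.univ (fun _ : ι => Set.Icc (-1 : ℝ) 1))ᶜ = 0 := by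
    rw [Measure.map_apply hr.measurable (MeasurableSet.univ_pi fun _ => measurableSet_Icc).compl]
    refine measure_mono_null (fun x hx => ?_) hΛ1
    simp only [Set.mem_preimage, Set.mem_compl_iff, Set.mem_univ_pi] at hx ⊢
    exact fun h => hx fun i => h (os i)
  have hlim : ∀ g : (ι → ℝ) → ℝ, Continuous g →
      Tendsto (fun K => ∫ U, g (fun i => prodObs S K (os i) U) ∂gibbsMeasure (S.P K) (S.β K)) atTop
        (𝓝 (∫ y, g y ∂(Λ.map fun x : List O → ℝ => fun i => x (os i)))) := fun g hg => by
    rw [integral_map hr.measurable.aemeasurable hg.aestronglyMeasurable]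
    exact hΛ (fun x => g (fun i => x (os i))) (hg.comp hr)
  rw [← integral_map hr.measurable.aemeasurable hf.aestronglyMeasurable]
  exact abs_integral_sub_jointLaw_le_of_uniformTarget S hβ hm h1 hl₀ hT os _ hc hlim hf hK0 hK hG hn K

/-- **★ EXISTENCE + RATE PACKAGED**: under uniform `Target` (`0 < l₀`), for every finite family of strings the continuum joint law `ν` EXISTS (p558060 via
`HasContinuumLimit`) and obeys the rate of the previous theorem for every admissible `f`, `n ≥ 1`, `K`. [bookkeeping] -/
theorem exists_jointLaw_rate_of_uniformTarget {ι : Type*} [Fintype ι] [DecidableEq ι] {vol l₀ : ℝ} {δ : ℕ → ℝ} (hl₀ : 0 < l₀)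
    (hT : ∀ os : List O, NE7.Target vol l₀ δ (schemeZ S os)) (os : ι → List O) :
    ∃ ν : Measure (ι → ℝ), IsProbabilityMeasure ν ∧ ν (Set.pi Set.univ (fun _ : ι => Set.Icc (-1 : ℝ) 1))ᶜ = 0 ∧
      (∀ f : (ι → ℝ) → ℝ, Continuous f →
        Tendsto (fun K => ∫ U, f (fun i => prodObs S K (os i) U) ∂gibbsMeasure (S.P K) (S.β K)) atTop (𝓝 (∫ x, f x ∂ν))) ∧
      ∀ (f : (ι → ℝ) → ℝ), Continuous f → ∀ (Kf Gf : ℝ), 0 ≤ Kf →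
        (∀ u v : ι → ℝ, (∀ i, u i ∈ Set.Icc (-1 : ℝ) 1) → (∀ i, v i ∈ Set.Icc (-1 : ℝ) 1) → |f u - f v| ≤ Kf * ∑ i, |u i - v i|) →
        (∀ u : ι → ℝ, (∀ i, u i ∈ Set.Icc (-1 : ℝ) 1) → |f u| ≤ Gf) → ∀ n : ℕ, n ≠ 0 → ∀ K : ℕ,
          |∫ U, f (fun i => prodObs S K (os i) U) ∂gibbsMeasure (S.P K) (S.β K) - ∫ x, f x ∂ν| ≤
            2 * Kf * (Fintype.card ι / Real.sqrt n) + Gf * 2 ^ (n * Fintype.card ι) *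
              (4 * Real.exp (1 + l₀) / l₀ * (∑' m, 2 * (vol * δ (K + m))) * (1 + Real.posLog (∑' m, 2 * (vol * δ (K + m)))⁻¹)) := by
  obtain ⟨ν, iν, hν1, hν, -⟩ := exists_jointContinuumLaw_of_hasContinuumLimit S hβ hm h1 (hasContinuumLimit_of_uniformTarget S hβ hm h1 hl₀ hT) os
  exact ⟨ν, iν, hν1, hν, fun f hf Kf Gf hK0 hK hG n hn K =>
    abs_integral_sub_jointLaw_le_of_uniformTarget S hβ hm h1 hl₀ hT os ν hν1 hν hf hK0 hK hG hn K⟩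

end Scheme

end Summit.QuantumFields.YangMills.Theorems.BalabanUVNodesN19JointLawRate

end
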